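import Summits.QuantumFields.GaugeBoot.TensorKronecker
import HarnessLib

/-!
# Slot-symmetric operators: the span of the tensor powers, and the slot sums (gauge-boot, FFT 2/7)

HONEST FRAMING (cell `pub-gaugeboot`, page 1 of every file): the venture produces certified bounds
on lattice expectations at stated coupling, gauge group, dimension and torus size; NOT a mass gap,
NOT a continuum limit, NOT a string tension; NOT Yang–Mills-summit-bearing (barriers
`FixedCouplingUltralocality`, `PerturbativeInvisibility`). Pure linear algebra; no number is
certified. Second brick of the lane's first fundamental theorem for lattice gauge invariants
(`TensorKronecker.lean` has the objects).

## Content (slots `κ`, colours `n`, field `𝕜` of characteristic zero)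

* ★★ `mem_span_kronPow_of_perm_invariant` / `mem_span_kronPow_of_forall_commute_permMat` — a
  matrix on words `κ → n` invariant under simultaneous slot permutation of rows and columns
  (equivalently: commuting with every `permMat σ`) is a linear combination of tensor powers
  `X^{⊗κ}` (polarization, `sum_perm_kron_comp`): the half `End_{S_κ}(V^{⊗κ}) ⊆ span {X^{⊗κ}}` of
  Schur–Weyl duality (Goodman–Wallach GTM 255 §4.2.4).
* `slotOp k X` — `X` acting in slot `k` (identity elsewhere); `slotSum X = ∑_k slotOp k X` — the
  infinitesimal tensor power (the derivative of `(e^{tX})^{⊗κ}` at `t = 0`, FFT 3/7);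
  `slotOp_mul`, `commute_slotOp`, `slotOp_pow`, `slotSum_add`, `slotSum_smul`.
* `esymm_mem_adjoin_psum` — Newton's identities (Mathlib `MvPolynomial.mul_esymm_eq_sum`): in
  characteristic zero every elementary symmetric polynomial is a polynomial in the power sums.
* ★★ `commute_kronPow_of_forall_commute_slotSum` — a matrix commuting with every slot sum
  `slotSum Y` commutes with every tensor power `X^{⊗κ}`: the slot operators `X_(k)` of ONE matrix
  commute pairwise, `slotSum (X^m)` is their `m`-th power sum and `X^{⊗κ}` their top elementary
  symmetric function.

Elementary (Weyl's unitarian trick at the Lie-algebra level); not located in Mathlib.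
-/

namespace Summit.QuantumFields.GaugeBoot

namespace TensorFFT

open Matrix Finset

variable {κ n : Type*}

/-! ## Slot-symmetric matrices are spanned by tensor powers -/

section Field

variable [Fintype κ] [DecidableEq κ] [Fintype n] [DecidableEq n] {𝕜 : Type*} [Field 𝕜] [CharZero 𝕜]

omit [DecidableEq κ] [Fintype n] [CharZero 𝕜] in
/-- A matrix unit on words is the Kronecker product of matrix units on letters. -/
theorem single_eq_kron (a b : κ → n) :
    (Matrix.single a b (1 : 𝕜) : Matrix (κ → n) (κ → n) 𝕜) =
      kron fun k => Matrix.single (a k) (b k) (1 : 𝕜) := by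
  ext x y
  simp only [Matrix.single, of_apply, kron_apply]
  rw [prod_boole]
  simp only [mem_univ, forall_const, funext_iff, ← forall_and]

omit [Fintype n] [CharZero 𝕜] in
/-- ★ The symmetrised matrix unit `∑_σ E_{a∘σ, b∘σ}` lies in the span of the tensor powers. -/
theorem sum_perm_single_mem_span (a b : κ → n) :
    (∑ σ : Equiv.Perm κ, Matrix.single (a ∘ σ) (b ∘ σ) (1 : 𝕜) : Matrix (κ → n) (κ → n) 𝕜) ∈
      Submodule.span 𝕜 (Set.range (kronPow (κ := κ) (n := n) (R := 𝕜))) := by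
  set A : κ → Matrix n n 𝕜 := fun i => Matrix.single (a i) (b i) (1 : 𝕜) with hA
  have e : (∑ σ : Equiv.Perm κ, Matrix.single (a ∘ σ) (b ∘ σ) (1 : 𝕜) : Matrix (κ → n) (κ → n) 𝕜) =
      ∑ σ : Equiv.Perm κ, kron (fun k => A (σ k)) := by
    refine sum_congr rfl fun σ _ => ?_
    rw [single_eq_kron]
    rfl
  rw [e, sum_perm_kron_comp A]
  refine Submodule.sum_mem _ fun S _ => Submodule.smul_mem _ _ (Submodule.subset_span ⟨_, rfl⟩)

omit [DecidableEq n] in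
/-- Re-indexing a double sum over words by a slot permutation. -/
theorem sum_sum_comp_perm {M : Type*} [AddCommMonoid M] (σ : Equiv.Perm κ)
    (F : (κ → n) → (κ → n) → M) :
    ∑ x : κ → n, ∑ y : κ → n, F (x ∘ σ) (y ∘ σ) = ∑ x : κ → n, ∑ y : κ → n, F x y := by
  have hx := Fintype.sum_equiv (σ.symm.arrowCongr (Equiv.refl n))
    (fun x : κ → n => ∑ y : κ → n, F (x ∘ σ) (y ∘ σ)) (fun x => ∑ y : κ → n, F x (y ∘ σ)) (fun x => rfl)
  rw [hx]
  refine sum_congr rfl fun x _ => ?_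
  exact Fintype.sum_equiv (σ.symm.arrowCongr (Equiv.refl n)) (fun y : κ → n => F x (y ∘ σ))
    (fun y => F x y) (fun y => rfl)

/-- ★★ **Slot-symmetric matrices are combinations of tensor powers** (the half
`End_{S_κ}(V^{⊗κ}) ⊆ span {X^{⊗κ}}` of Schur–Weyl duality, by polarization): if
`B (x ∘ σ) (y ∘ σ) = B x y` for all slot permutations `σ`, then `B ∈ span_𝕜 {kronPow X}`.
[cite: GoodmanWallachGTM255, §4.2.4] -/
theorem mem_span_kronPow_of_perm_invariant {B : Matrix (κ → n) (κ → n) 𝕜}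
    (hB : ∀ (σ : Equiv.Perm κ) (x y : κ → n), B (x ∘ σ) (y ∘ σ) = B x y) :
    B ∈ Submodule.span 𝕜 (Set.range (kronPow (κ := κ) (n := n) (R := 𝕜))) := by
  classical
  set p : ℕ := Fintype.card (Equiv.Perm κ) with hp
  have hp0 : (p : 𝕜) ≠ 0 := by exact_mod_cast Fintype.card_ne_zero
  have hB' : ∀ σ : Equiv.Perm κ,
      B = ∑ x : κ → n, ∑ y : κ → n, B x y • Matrix.single (x ∘ σ) (y ∘ σ) (1 : 𝕜) := by
    intro σ
    have h3 := sum_sum_comp_perm σ (fun x y => B x y • Matrix.single x y (1 : 𝕜))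
    simp only [hB] at h3
    rw [h3]
    conv_lhs => rw [matrix_eq_sum_single B]
    refine sum_congr rfl fun x _ => sum_congr rfl fun y _ => ?_
    rw [Matrix.smul_single, smul_eq_mul, mul_one]
  have hsum : (p : 𝕜) • B =
      ∑ x : κ → n, ∑ y : κ → n, B x y • ∑ σ : Equiv.Perm κ, Matrix.single (x ∘ σ) (y ∘ σ) (1 : 𝕜) := by
    calc (p : 𝕜) • B = ∑ _σ : Equiv.Perm κ, B := by
          rw [sum_const, card_univ, ← Nat.cast_smul_eq_nsmul 𝕜]
      _ = ∑ σ : Equiv.Perm κ, ∑ x : κ → n, ∑ y : κ → n, B x y • Matrix.single (x ∘ σ) (y ∘ σ) (1 : 𝕜) :=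
          sum_congr rfl fun σ _ => hB' σ
      _ = _ := by
          rw [sum_comm]
          refine sum_congr rfl fun x _ => ?_
          rw [sum_comm]
          refine sum_congr rfl fun y _ => ?_
          rw [smul_sum]
  have hmem : (p : 𝕜) • B ∈ Submodule.span 𝕜 (Set.range (kronPow (κ := κ) (n := n) (R := 𝕜))) := by
    rw [hsum]
    exact Submodule.sum_mem _ fun x _ => Submodule.sum_mem _ fun y _ =>
      Submodule.smul_mem _ _ (sum_perm_single_mem_span x y)
  have e : B = (p : 𝕜)⁻¹ • ((p : 𝕜) • B) := by rw [smul_smul, inv_mul_cancel₀ hp0, one_smul]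
  rw [e]
  exact Submodule.smul_mem _ _ hmem

/-- ★★ Matrix form: a matrix commuting with every slot permutation operator lies in the span of
the tensor powers. -/
theorem mem_span_kronPow_of_forall_commute_permMat {B : Matrix (κ → n) (κ → n) 𝕜}
    (hB : ∀ σ : Equiv.Perm κ, Commute (permMat σ) B) :
    B ∈ Submodule.span 𝕜 (Set.range (kronPow (κ := κ) (n := n) (R := 𝕜))) := by
  refine mem_span_kronPow_of_perm_invariant fun σ x y => ?_
  have h := congrFun (congrFun (hB σ).eq x) (y ∘ σ)
  rw [permMat_mul_apply, mul_permMat_apply] at h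
  rw [h]
  congr 1
  funext k
  simp

end Field

/-! ## Slot operators and slot sums -/

section Slot

variable {R : Type*} [CommRing R] [Fintype κ] [DecidableEq κ] [Fintype n] [DecidableEq n]

omit [Fintype n] in
/-- **Slot operator** `X_(k)`: the matrix `X` acting in slot `k`, the identity in every other
slot (`kron` of the family `1` updated at `k`). [folklore] -/
def slotOp (k : κ) (X : Matrix n n R) : Matrix (κ → n) (κ → n) R := kron (Function.update 1 k X)

omit [Fintype n] in
/-- `slotOp` unfolded. -/
theorem slotOp_def (k : κ) (X : Matrix n n R) :
    slotOp k X = (kron (Function.update 1 k X) : Matrix (κ → n) (κ → n) R) := rfl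

omit [Fintype n] in
/-- `X_(k)` for `X = 1` is the identity. -/
@[simp] theorem slotOp_one (k : κ) : slotOp k (1 : Matrix n n R) = (1 : Matrix (κ → n) (κ → n) R) := by
  rw [slotOp_def, show (1 : Matrix n n R) = (1 : κ → Matrix n n R) k from rfl, Function.update_eq_self,
    kron_one]

omit [Fintype n] in
/-- `slotOp` is additive. -/
theorem slotOp_add (k : κ) (X Y : Matrix n n R) :
    slotOp k (X + Y) = (slotOp k X + slotOp k Y : Matrix (κ → n) (κ → n) R) :=
  kron_update_add 1 k X Y

omit [Fintype n] in
/-- `slotOp` is homogeneous. -/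
theorem slotOp_smul (k : κ) (c : R) (X : Matrix n n R) :
    slotOp k (c • X) = (c • slotOp k X : Matrix (κ → n) (κ → n) R) :=
  kron_update_smul 1 k c X

/-- ★ Slot operators in the same slot multiply like the letters. -/
theorem slotOp_mul (k : κ) (X Y : Matrix n n R) :
    slotOp k X * slotOp k Y = (slotOp k (X * Y) : Matrix (κ → n) (κ → n) R) := by
  rw [slotOp_def, slotOp_def, slotOp_def, kron_mul]
  congr 1
  funext j
  by_cases h : j = k
  · subst h; simp
  · simp [Function.update_of_ne h]

/-- ★ Slot operators in different slots commute. -/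
theorem commute_slotOp {k l : κ} (h : k ≠ l) (X Y : Matrix n n R) :
    Commute (slotOp k X) (slotOp l Y : Matrix (κ → n) (κ → n) R) := by
  change slotOp k X * slotOp l Y = slotOp l Y * slotOp k X
  rw [slotOp_def, slotOp_def, kron_mul, kron_mul]
  congr 1
  funext j
  by_cases hk : j = k
  · subst hk; simp [Function.update_of_ne h]
  · by_cases hl : j = l
    · subst hl; simp [Function.update_of_ne (Ne.symm h)]
    · simp [Function.update_of_ne hk, Function.update_of_ne hl]

/-- Powers of a slot operator. -/
theorem slotOp_pow (k : κ) (X : Matrix n n R) (m : ℕ) :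
    slotOp k X ^ m = (slotOp k (X ^ m) : Matrix (κ → n) (κ → n) R) := by
  induction m with
  | zero => rw [pow_zero, pow_zero, slotOp_one]
  | succ m ih => rw [pow_succ, ih, slotOp_mul, pow_succ]

/-- **Slot sum** `Δ(X) = ∑_k X_(k)` — the infinitesimal tensor power. [folklore] -/
def slotSum (X : Matrix n n R) : Matrix (κ → n) (κ → n) R := ∑ k, slotOp k X

omit [Fintype n] in
/-- `slotSum` unfolded. -/
theorem slotSum_def (X : Matrix n n R) : (slotSum X : Matrix (κ → n) (κ → n) R) = ∑ k, slotOp k X := rfl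

omit [Fintype n] in
/-- `slotSum` is additive. -/
theorem slotSum_add (X Y : Matrix n n R) :
    (slotSum (X + Y) : Matrix (κ → n) (κ → n) R) = slotSum X + slotSum Y := by
  simp only [slotSum_def, slotOp_add, sum_add_distrib]

omit [Fintype n] in
/-- `slotSum` is homogeneous. -/
theorem slotSum_smul (c : R) (X : Matrix n n R) :
    (slotSum (c • X) : Matrix (κ → n) (κ → n) R) = c • slotSum X := by
  simp only [slotSum_def, slotOp_smul, smul_sum]

omit [Fintype n] in
/-- `slotSum 1 = |κ| • 1` is central. -/
theorem slotSum_one : (slotSum (1 : Matrix n n R) : Matrix (κ → n) (κ → n) R) = (Fintype.card κ : R) • 1 := by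
  simp only [slotSum_def, slotOp_one, sum_const, card_univ, Nat.cast_smul_eq_nsmul]

end Slot

/-! ## Newton: commuting with the slot sums forces commuting with the tensor powers -/

section Newton

variable [Fintype κ] [DecidableEq κ] [Fintype n] [DecidableEq n] {𝕜 : Type*} [Field 𝕜] [CharZero 𝕜]

omit [DecidableEq κ] in
/-- **Newton's identities, membership form**: in characteristic zero every elementary symmetric
polynomial lies in the subalgebra generated by the power sums `p_1, p_2, …`
(Mathlib `MvPolynomial.mul_esymm_eq_sum`). [folklore] -/
theorem esymm_mem_adjoin_psum (k : ℕ) :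
    MvPolynomial.esymm κ 𝕜 k ∈
      Algebra.adjoin 𝕜 (Set.range fun m : ℕ => MvPolynomial.psum κ 𝕜 (m + 1)) := by
  classical
  induction k using Nat.strong_induction_on with
  | _ k ih =>
    rcases Nat.eq_zero_or_pos k with rfl | hk
    · rw [MvPolynomial.esymm_zero]; exact Subalgebra.one_mem _
    · have hmem : (k : MvPolynomial κ 𝕜) * MvPolynomial.esymm κ 𝕜 k ∈
          Algebra.adjoin 𝕜 (Set.range fun m : ℕ => MvPolynomial.psum κ 𝕜 (m + 1)) := by
        rw [MvPolynomial.mul_esymm_eq_sum κ 𝕜 k]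
        refine Subalgebra.mul_mem _ (Subalgebra.pow_mem _ (Subalgebra.neg_mem _ (Subalgebra.one_mem _)) _)
          (Subalgebra.sum_mem _ fun a ha => ?_)
        obtain ⟨ha1, ha2⟩ := mem_filter.1 ha
        refine Subalgebra.mul_mem _ (Subalgebra.mul_mem _
          (Subalgebra.pow_mem _ (Subalgebra.neg_mem _ (Subalgebra.one_mem _)) _) (ih a.1 ha2)) ?_
        have ha3 : a.2 = (a.2 - 1) + 1 := by
          have := mem_antidiagonal.1 ha1; omega
        rw [ha3]
        exact Algebra.subset_adjoin ⟨a.2 - 1, rfl⟩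
      have hk' : (k : 𝕜) ≠ 0 := by exact_mod_cast hk.ne'
      have e : MvPolynomial.esymm κ 𝕜 k =
          (k : 𝕜)⁻¹ • ((k : MvPolynomial κ 𝕜) * MvPolynomial.esymm κ 𝕜 k) := by
        rw [← map_natCast (algebraMap 𝕜 (MvPolynomial κ 𝕜)) k, ← Algebra.smul_def, smul_smul,
          inv_mul_cancel₀ hk', one_smul]
      rw [e]
      exact Subalgebra.smul_mem _ hmem _

open scoped IsMulCommutative in
/-- ★★ **Commuting with every slot sum forces commuting with every tensor power.** The slot
operators `X_(k)` of one matrix commute pairwise; `slotSum (X^m) = ∑_k X_(k)^m` are their power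
sums and `X^{⊗κ} = ∏_k X_(k)` their top elementary symmetric function, a polynomial in the power
sums by Newton's identities (characteristic zero). [folklore] -/
theorem commute_kronPow_of_forall_commute_slotSum {T : Matrix (κ → n) (κ → n) 𝕜}
    (hT : ∀ Y : Matrix n n 𝕜, Commute (slotSum Y) T) (X : Matrix n n 𝕜) :
    Commute (kronPow X : Matrix (κ → n) (κ → n) 𝕜) T := by
  classical
  -- the commutative subalgebra generated by the slot operators of `X`
  set S : Subalgebra 𝕜 (Matrix (κ → n) (κ → n) 𝕜) :=
    Algebra.adjoin 𝕜 (Set.range fun k : κ => slotOp k X) with hSdef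
  haveI : IsMulCommutative S := Algebra.isMulCommutative_adjoin 𝕜 (by
    rintro _ ⟨k, rfl⟩ _ ⟨l, rfl⟩
    by_cases h : k = l
    · subst h; rfl
    · exact (commute_slotOp h X X).eq)
  let x : κ → S := fun k => ⟨slotOp k X, Algebra.subset_adjoin ⟨k, rfl⟩⟩
  let φ := MvPolynomial.aeval (R := 𝕜) x
  let ψ : MvPolynomial κ 𝕜 →ₐ[𝕜] Matrix (κ → n) (κ → n) 𝕜 := S.val.comp φ
  have hψX : ∀ k, ψ (MvPolynomial.X k) = slotOp k X := fun k => by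
    simp only [ψ, φ, AlgHom.comp_apply, MvPolynomial.aeval_X, Subalgebra.coe_val, x]
  -- power sums go to slot sums of powers
  have hpsum : ∀ m, ψ (MvPolynomial.psum κ 𝕜 m) = slotSum (X ^ m) := by
    intro m
    simp only [MvPolynomial.psum, map_sum, map_pow, hψX, slotOp_pow, slotSum_def]
  -- products of the generators inside the commutative subalgebra
  have hprod : ∀ t : Finset κ, ((∏ k ∈ t, x k : S) : Matrix (κ → n) (κ → n) 𝕜) =
      kron fun j => if j ∈ t then X else 1 := by
    intro t
    induction t using Finset.induction_on with
    | empty =>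
      simp only [prod_empty, Subalgebra.coe_one, notMem_empty, if_false, kron_const_one]
    | insert i t hi ih =>
      rw [prod_insert hi]
      have e : (((x i * ∏ k ∈ t, x k : S)) : Matrix (κ → n) (κ → n) 𝕜) =
          (x i : Matrix (κ → n) (κ → n) 𝕜) * ((∏ k ∈ t, x k : S) : Matrix (κ → n) (κ → n) 𝕜) := rfl
      rw [e, ih]
      change slotOp i X * _ = _
      rw [slotOp_def, kron_mul]
      congr 1
      funext j
      by_cases hj : j = i
      · subst hj; simp [hi]
      · simp [hj]
  -- the top elementary symmetric function goes to the tensor power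
  have hesymm : ψ (MvPolynomial.esymm κ 𝕜 (Fintype.card κ)) = kronPow X := by
    have h1 : MvPolynomial.esymm κ 𝕜 (Fintype.card κ) = ∏ i, MvPolynomial.X i := by
      simp only [MvPolynomial.esymm]
      rw [← card_univ, powersetCard_self, sum_singleton]
    rw [h1]
    change ((φ (∏ i, MvPolynomial.X i) : S) : Matrix (κ → n) (κ → n) 𝕜) = kronPow X
    rw [map_prod]
    simp_rw [show ∀ k, φ (MvPolynomial.X k) = x k from fun k => MvPolynomial.aeval_X x k]
    rw [hprod univ]
    simp only [mem_univ, if_true]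
    rfl
  -- the subalgebra of symmetric functions whose image commutes with `T`
  let D : Subalgebra 𝕜 (MvPolynomial κ 𝕜) := (Subalgebra.centralizer 𝕜 {T}).comap ψ
  have hD : Algebra.adjoin 𝕜 (Set.range fun m : ℕ => MvPolynomial.psum κ 𝕜 (m + 1)) ≤ D := by
    refine Algebra.adjoin_le ?_
    rintro _ ⟨m, rfl⟩
    rw [SetLike.mem_coe, Subalgebra.mem_comap, Subalgebra.mem_centralizer_iff, hpsum]
    intro g hg
    rw [Set.mem_singleton_iff.1 hg]
    exact (hT (X ^ (m + 1))).eq.symm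
  have hmem := hD (esymm_mem_adjoin_psum (κ := κ) (𝕜 := 𝕜) (Fintype.card κ))
  rw [Subalgebra.mem_comap, Subalgebra.mem_centralizer_iff, hesymm] at hmem
  exact (hmem T (Set.mem_singleton T)).symm

end Newton

end TensorFFT

end Summit.QuantumFields.GaugeBoot
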